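import Literature.Probability.RandomPlanarGeometry.YangBaxterSAW
import HarnessLib

/-!
# Glazman–Manolescu, Theorem 1: the architecture of the proof

Topic `Literature/Probability/RandomPlanarGeometry`; support file for the discharge of the named
fact `Literature.Probability.RandomPlanarGeometry.SAW.YangBaxter.GlazmanManolescu2019_thm1`
(`YangBaxterSAW.lean`): A. Glazman, I. Manolescu, *Self-avoiding walk on `ℤ²` with Yang–Baxter
weights: universality of critical fugacity and 2-point function*, Ann. Inst. Henri Poincaré
Probab. Stat. 56 (2020), arXiv:1708.00395 (`GlazmanManolescu2019`; the numbering is that of the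
arXiv/journal version held in the store), **Theorem 1**: for `θ_k ∈ [π/3, 2π/3]`,
`G_Θ(a, b) = G_{π/3}(a, b)` for all boundary points `a, b` of the half-plane.

The printed proof (§4.2, p. 12) combines three independent inputs, vendored here as named
facts with the paper's numbering, and an assembly argument, proved here:

* `GlazmanManolescu2019_cor23` — **Corollary 2.3** (p. 6), the strip identity of the
  parafermionic observable: `cos(3π/8) A_{T,Θ} + B_{T,Θ} = 1`, where
  `A_{T,Θ} = arcPartitionFunction T Θ` is the partition function of arcs (walks of `Strip_T`
  from `0` back to the left boundary, the empty walk excluded: "the factor `1` on the right-hand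
  side … comes from the contribution to `F` of the empty configuration, which is not accounted
  for in any of the terms on the left-hand side", p. 6) and `B_{T,Θ} = bridgePartitionFunction`
  (eq. (2)). Its proof is Lemma 2.1 (discrete Cauchy–Riemann relation of the observable, from
  [Gl]) and Lemma 2.2 (= [Gl, Lem. 4.1]) plus a limit `L → ∞`; not formalised.
* `GlazmanManolescu2019_prop11_limit` — the consequence "`B_T(π/3) → 0` as `T → ∞`" printed in
  **Proposition 1.1** (p. 4; proved in §4.1 by the rotational symmetry of the hexagonal
  lattice; originally [BBDDG]); not formalised.
* `GlazmanManolescu2019_prop42` — **Proposition 4.2** (p. 11): in a strip, the boundary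
  two-point function does not depend on the order of the columns' angles (Yang–Baxter
  transformations on general rhombic tilings, §3); not formalised.
* `GlazmanManolescu2019_lem43` — **Lemma 4.3** (p. 12): replacing the angle of the last column
  by `π/3` does not increase the two-point function between left-boundary points; vendored as a
  fact (its proof is an explicit per-walk weight comparison, to be formalised separately).
* `GlazmanManolescu2019_cor44_of` — **Corollary 4.4**, eq. (4.5) (p. 12):
  `G_{Strip_T(Θ)}(a, b) ≥ G_{Strip_T(π/3)}(a, b)`, PROVED here from Prop. 4.2 and Lemma 4.3
  exactly as printed ("apply repeatedly (4.4)"). Corollary 4.4 is deliberately NOT a separate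
  named fact: its whole printed proof is Prop. 4.2 + Lemma 4.3, so a `def … : Prop` for it would
  only re-count the Proposition 4.2 debt (D-0026); the bound (4.5) is spelled out where it is used.
* `GlazmanManolescu2019_thm1_of` — **Theorem 1 from Cor. 2.3, Prop. 1.1 and the bound (4.5)**, the
  argument of p. 12: `A_{T,Θ} = Σ_L G_{Strip_T(Θ)}(0, L) ≥ A_{T,π/3} → 1/cos(3π/8)` while
  `A_{T,Θ} ≤ 1/cos(3π/8)`; exchanging `Σ_L` and `lim_T` (monotone convergence,
  `twoPoint_halfPlane_eq_iSup`, `iSup_arcPartitionFunction`) gives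
  `Σ_L G_Θ(0, L) = Σ_L G_{π/3}(0, L) = 1/cos(3π/8) < ∞` with `G_Θ(0, L) ≥ G_{π/3}(0, L)`
  termwise, hence equality termwise; finally `G_Θ(a, b) = G_Θ(0, b − a)`
  (`halfPlaneTwoPoint_eq_zero_sub`).

So `GlazmanManolescu2019_thm1_holds` will read
`GlazmanManolescu2019_thm1_of cor23_holds prop11_limit_holds (GlazmanManolescu2019_cor44_of prop42_holds lem43_holds)`
once the four facts are discharged (Lemma 4.3: `YangBaxterSAWStripMonotone.lean`; Cor. 2.3:
`YangBaxterSAWExcursion.lean`; Prop. 1.1: `YangBaxterSAWHexBridges.lean`; Prop. 4.2: open, see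
`YangBaxterSAWYBE.lean`).

## Infrastructure proved here (namespace `Literature.Probability.RandomPlanarGeometry.SAW.YangBaxter`)

* `YBWalk.eq_trivial_of_self`, `twoPoint_self`: the only walk from `a` to `a` is the empty one
  ("crosses any edge at most once"), so `G_D(a, a) = 1`;
* `YBWalk.weight_congr`, `twoPoint_congr`: locality — the weight of a walk of `D` only involves
  the angles `Θ k` of the columns `k` of faces of `D`;
* `MidEdge.shiftRow`, `YBWalk.shiftRow`, `YBWalk.shiftRowEquiv`, `twoPoint_shiftRow`,
  `halfPlaneTwoPoint_eq_zero_sub`: vertical translations ("the invariance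
  `G_Θ(a, b) = G_Θ(0, b − a)`", p. 12);
* `YBWalk.restrict`, `YBWalk.colBound`, `twoPoint_halfPlane_eq_iSup`: every walk of `H(Θ)` is a
  walk of some `Strip_T(Θ)`, so `G_{H(Θ)} = sup_T G_{Strip_T(Θ)}` ("`G_Θ(0, L) ≥ lim_T G_T(Θ)(0, L)`"
  and "`Σ_L lim_T = lim_T Σ_L`", p. 12);
* `stripBoundaryPoints`, `arcPartitionFunction` (`A_{T,Θ}`), `rotPerm` (the column rotation
  used in the proof of Cor. 4.4).

Partition functions are `ℝ≥0∞`-valued as in `YangBaxterSAW.lean`, so limits of increasing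
sequences are suprema and no summability bookkeeping is needed; Cor. 2.3 is accordingly stated
with `ENNReal.ofReal (cos(3π/8))`.
-/

noncomputable section

open Real Filter Topology
open scoped ENNReal

namespace Literature.Probability.RandomPlanarGeometry.SAW.YangBaxter

open MidEdge

/-! ### Walks from a point to itself; locality of the weight -/

namespace YBWalk

variable {D : Set Face} {a z : MidEdge}

/-- A walk crosses at least one mid-edge (its starting point). [folklore] -/
theorem mids_ne_nil (γ : YBWalk D a z) : γ.mids ≠ [] := by
  intro h
  have := γ.head_eq
  rw [h] at this
  simp at this

/-- A walk from `a` to `a` crosses only `a`: mid-edges are never repeated ("crosses any edge at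
most once"). [cite: GlazmanManolescu2019, §1 (definition of the model)] -/
theorem mids_eq_singleton_of_self (γ : YBWalk D a a) : γ.mids = [a] := by
  obtain ⟨l, h1, h2, h3⟩ : ∃ l, l = γ.mids ∧ l.head? = some a ∧ l.getLast? = some a :=
    ⟨γ.mids, rfl, γ.head_eq, γ.getLast_eq⟩
  have hnd : l.Nodup := h1 ▸ γ.nodup
  rw [← h1]
  match l, h2, h3, hnd with
  | [x], h2, _, _ => simpa using h2
  | x :: y :: l, h2, h3, hnd =>
    exfalso
    simp only [List.head?_cons, Option.some.injEq] at h2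
    subst h2
    rw [List.getLast?_eq_some_getLast (by simp)] at h3
    simp only [Option.some.injEq] at h3
    have hmem : (x :: y :: l).getLast (by simp) ∈ y :: l := by
      rw [List.getLast_cons (by simp)]
      exact List.getLast_mem _
    rw [h3] at hmem
    exact (List.nodup_cons.1 hnd).1 hmem

/-- The only walk from `a` to `a` is the empty one. [cite: GlazmanManolescu2019, §1] -/
theorem eq_trivial_of_self (γ : YBWalk D a a) : γ = trivial a :=
  YBWalk.ext (mids_eq_singleton_of_self γ)

/-- The type of walks from `a` to `a` is the singleton `{trivial a}`. [folklore] -/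
instance : Unique (YBWalk D a a) where
  default := trivial a
  uniq := eq_trivial_of_self

/-- Faces carrying an arc of a walk of `D` are faces of `D`. [folklore] -/
theorem mem_of_mem_facesVisited (γ : YBWalk D a z) {f : Face} (hf : f ∈ γ.facesVisited) : f ∈ D := by
  simp only [facesVisited, List.mem_toFinset, List.mem_filterMap] at hf
  obtain ⟨p, hp, hpf⟩ := hf
  obtain ⟨f', hf'D, hpf'⟩ := γ.arc_mem p hp
  rw [hpf'] at hpf
  cases hpf
  exact hf'D

/-- **Locality**: the weight of a walk of `D` only depends on the angles of the columns of `D`.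
[cite: GlazmanManolescu2019, §1 ("the product of weights associated to each rhombus")] -/
theorem weight_congr (γ : YBWalk D a z) {Θ Θ' : ℤ → ℝ} (h : ∀ f ∈ D, Θ f.1 = Θ' f.1) :
    γ.weight Θ = γ.weight Θ' := by
  unfold weight
  refine Finset.prod_congr rfl fun f hf => ?_
  rw [h f (γ.mem_of_mem_facesVisited hf)]

end YBWalk

/-- `G_D(a, a) = 1`: only the empty walk joins `a` to itself. [cite: GlazmanManolescu2019, §2.1
("the contribution … of the empty configuration")] -/
theorem twoPoint_self (D : Set Face) (Θ : ℤ → ℝ) (a : MidEdge) : twoPoint D Θ a a = 1 := by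
  unfold twoPoint
  rw [tsum_eq_single (YBWalk.trivial a) fun γ hγ => absurd (YBWalk.eq_trivial_of_self γ) hγ]
  simp

/-- **Locality** of the two-point function: `G_D` only depends on the angles of the columns
meeting `D`. [cite: GlazmanManolescu2019, §1] -/
theorem twoPoint_congr (D : Set Face) {Θ Θ' : ℤ → ℝ} (h : ∀ f ∈ D, Θ f.1 = Θ' f.1) (a z : MidEdge) :
    twoPoint D Θ a z = twoPoint D Θ' a z := by
  unfold twoPoint
  exact tsum_congr fun γ => by rw [γ.weight_congr h]

/-! ### Vertical translations -/

/-- Vertical translation of faces by `d` rows. [folklore] -/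
def Face.shiftRow (d : ℤ) (f : Face) : Face := (f.1, f.2 + d)

/-- Vertical translation of mid-edges by `d` rows. [folklore] -/
def MidEdge.shiftRow (d : ℤ) : MidEdge → MidEdge
  | .vert k j => .vert k (j + d)
  | .slant k j => .slant k (j + d)

/-- Translation keeps the column. [folklore] -/
@[simp] theorem Face.shiftRow_fst (d : ℤ) (f : Face) : (Face.shiftRow d f).1 = f.1 := rfl

/-- Translating back. [folklore] -/
@[simp] theorem Face.shiftRow_shiftRow_neg (d : ℤ) (f : Face) :
    Face.shiftRow (-d) (Face.shiftRow d f) = f := by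
  unfold Face.shiftRow; ext <;> simp

/-- Translating forth. [folklore] -/
@[simp] theorem Face.shiftRow_neg_shiftRow (d : ℤ) (f : Face) :
    Face.shiftRow d (Face.shiftRow (-d) f) = f := by
  unfold Face.shiftRow; ext <;> simp

/-- Translation of faces is injective. [folklore] -/
theorem Face.shiftRow_injective (d : ℤ) : Function.Injective (Face.shiftRow d) := fun f g h => by
  rw [← Face.shiftRow_shiftRow_neg d f, h, Face.shiftRow_shiftRow_neg]

/-- Translating back. [folklore] -/
@[simp] theorem MidEdge.shiftRow_shiftRow_neg (d : ℤ) (e : MidEdge) :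
    (e.shiftRow d).shiftRow (-d) = e := by
  cases e <;> simp [MidEdge.shiftRow]

/-- Translating forth. [folklore] -/
@[simp] theorem MidEdge.shiftRow_neg_shiftRow (d : ℤ) (e : MidEdge) :
    (e.shiftRow (-d)).shiftRow d = e := by
  cases e <;> simp [MidEdge.shiftRow]

/-- Translation of mid-edges is injective. [folklore] -/
theorem MidEdge.shiftRow_injective (d : ℤ) : Function.Injective (MidEdge.shiftRow d) := fun e e' h => by
  rw [← MidEdge.shiftRow_shiftRow_neg d e, h, MidEdge.shiftRow_shiftRow_neg]

/-- Translation commutes with "the two faces bordering a mid-edge". [folklore] -/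
theorem MidEdge.faces_shiftRow (d : ℤ) (e : MidEdge) :
    (e.shiftRow d).faces = (Face.shiftRow d e.faces.1, Face.shiftRow d e.faces.2) := by
  cases e with
  | vert k j => simp [MidEdge.shiftRow, MidEdge.faces, Face.shiftRow]
  | slant k j =>
    simp only [MidEdge.shiftRow, MidEdge.faces, Face.shiftRow, Prod.mk.injEq, and_true, true_and]
    ring

/-- Translation commutes with "the common face of two mid-edges". [folklore] -/
theorem MidEdge.commonFace_shiftRow (d : ℤ) (e e' : MidEdge) :
    commonFace (e.shiftRow d) (e'.shiftRow d) = (commonFace e e').map (Face.shiftRow d) := by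
  unfold commonFace
  simp only [(MidEdge.shiftRow_injective d).eq_iff, MidEdge.faces_shiftRow,
    (Face.shiftRow_injective d).eq_iff]
  split_ifs <;> simp

/-- Translation preserves "which side of a face a mid-edge is". [folklore] -/
theorem Face.sideOf_shiftRow (d : ℤ) (f : Face) (e : MidEdge) :
    Face.sideOf (Face.shiftRow d f) (e.shiftRow d) = f.sideOf e := by
  have h : ∀ j : ℤ, j + d = f.2 + d + 1 ↔ j = f.2 + 1 := fun j => by omega
  cases e <;> simp [Face.sideOf, MidEdge.shiftRow, Face.shiftRow, h]

/-- Translation commutes with "the mid-edge on a given side of a face". [folklore] -/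
theorem Face.side_shiftRow (d : ℤ) (f : Face) (s : Side) :
    (Face.shiftRow d f).side s = (f.side s).shiftRow d := by
  cases s <;> (simp [Face.side, MidEdge.shiftRow, Face.shiftRow]; try ring)

/-- The arcs of a mapped list of mid-edges. [folklore] -/
theorem arcsOf_map (φ : MidEdge → MidEdge) (l : List MidEdge) :
    arcsOf (l.map φ) = (arcsOf l).map (Prod.map φ φ) := by
  rw [arcsOf, arcsOf, ← List.map_tail, List.zip_map]

/-- Translation commutes with "the face of an arc". [folklore] -/
theorem arcFace_shiftRow (d : ℤ) (p : MidEdge × MidEdge) :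
    arcFace (Prod.map (MidEdge.shiftRow d) (MidEdge.shiftRow d) p) = (arcFace p).map (Face.shiftRow d) :=
  MidEdge.commonFace_shiftRow d p.1 p.2

/-- Translation preserves the kind of an arc. [folklore] -/
theorem arcKindOf_shiftRow (d : ℤ) (p : MidEdge × MidEdge) :
    arcKindOf (Prod.map (MidEdge.shiftRow d) (MidEdge.shiftRow d) p) = arcKindOf p := by
  unfold arcKindOf
  rw [arcFace_shiftRow]
  cases arcFace p with
  | none => rfl
  | some f => simp [Face.sideOf_shiftRow]

namespace YBWalk

variable {D : Set Face} {a z : MidEdge}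

/-- Vertical translation of a walk by `d` rows (its domain is translated along).
[cite: GlazmanManolescu2019, §4.2 ("the invariance G_Θ(a,b) = G_Θ(0,b−a)")] -/
def shiftRow (d : ℤ) (γ : YBWalk D a z) :
    YBWalk (Face.shiftRow (-d) ⁻¹' D) (a.shiftRow d) (z.shiftRow d) where
  mids := γ.mids.map (MidEdge.shiftRow d)
  head_eq := by rw [List.head?_map, γ.head_eq]; rfl
  getLast_eq := by rw [List.getLast?_map, γ.getLast_eq]; rfl
  nodup := γ.nodup.map (MidEdge.shiftRow_injective d)
  arc_mem p hp := by
    rw [arcsOf_map, List.mem_map] at hp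
    obtain ⟨q, hq, rfl⟩ := hp
    obtain ⟨f, hfD, hqf⟩ := γ.arc_mem q hq
    refine ⟨Face.shiftRow d f, ?_, ?_⟩
    · simpa using hfD
    · rw [arcFace_shiftRow, hqf]; rfl
  isChain := by
    rw [arcsOf_map]
    refine List.isChain_map_of_isChain _ (fun p q h => ?_) γ.isChain
    rw [arcFace_shiftRow, arcFace_shiftRow]
    exact fun h' => h (Option.map_injective (Face.shiftRow_injective d) h')
  noncross f := by
    have key : ∀ (g : Face) (s t : Side), ((Face.shiftRow d g).side s, (Face.shiftRow d g).side t) ∈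
        arcsOf (γ.mids.map (MidEdge.shiftRow d)) ↔ (g.side s, g.side t) ∈ arcsOf γ.mids := by
      intro g s t
      rw [arcsOf_map, Face.side_shiftRow, Face.side_shiftRow]
      exact List.mem_map_of_injective (a := (g.side s, g.side t))
        ((MidEdge.shiftRow_injective d).prodMap (MidEdge.shiftRow_injective d))
    have := γ.noncross (Face.shiftRow (-d) f)
    simpa only [← key (Face.shiftRow (-d) f), Face.shiftRow_neg_shiftRow] using this

/-- The mid-edges of a translated walk. [folklore] -/
@[simp] theorem mids_shiftRow (d : ℤ) (γ : YBWalk D a z) :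
    (γ.shiftRow d).mids = γ.mids.map (MidEdge.shiftRow d) := rfl

/-- The mid-edges of a walk viewed in a larger domain. [folklore] -/
@[simp] theorem mids_mapDomain {D' : Set Face} (h : D ⊆ D') (γ : YBWalk D a z) :
    (γ.mapDomain h).mids = γ.mids := rfl

/-- The faces visited by a translated walk. [folklore] -/
theorem facesVisited_shiftRow (d : ℤ) (γ : YBWalk D a z) :
    (γ.shiftRow d).facesVisited = γ.facesVisited.map ⟨_, Face.shiftRow_injective d⟩ := by
  unfold facesVisited arcs
  rw [mids_shiftRow, arcsOf_map, List.filterMap_map]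
  ext f
  simp only [List.mem_toFinset, List.mem_filterMap, Function.comp_apply, arcFace_shiftRow,
    Option.map_eq_some_iff, Finset.mem_map, Function.Embedding.coeFn_mk]
  grind

/-- The arcs of a translated walk in a translated face. [folklore] -/
theorem kindsIn_shiftRow (d : ℤ) (γ : YBWalk D a z) (f : Face) :
    (γ.shiftRow d).kindsIn (Face.shiftRow d f) = γ.kindsIn f := by
  unfold kindsIn arcs
  rw [mids_shiftRow, arcsOf_map, List.filterMap_map]
  congr 1
  funext p
  simp only [Function.comp_apply, arcFace_shiftRow, arcKindOf_shiftRow]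
  rcases h : arcFace p with _ | g
  · simp
  · simp [(Face.shiftRow_injective d).eq_iff]

/-- **Translation invariance of the weight.** [cite: GlazmanManolescu2019, §4.2] -/
theorem weight_shiftRow (d : ℤ) (Θ : ℤ → ℝ) (γ : YBWalk D a z) :
    (γ.shiftRow d).weight Θ = γ.weight Θ := by
  unfold weight
  rw [facesVisited_shiftRow, Finset.prod_map]
  refine Finset.prod_congr rfl fun f _ => ?_
  simp [kindsIn_shiftRow]

end YBWalk

/-- Domains that are unions of columns (such as `H(Θ)` and `Strip_T(Θ)`). [folklore] -/
def IsColumnSet (D : Set Face) : Prop := ∀ f ∈ D, ∀ j : ℤ, (f.1, j) ∈ D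

/-- A union of columns is invariant under vertical translations. [folklore] -/
theorem IsColumnSet.preimage_shiftRow {D : Set Face} (hD : IsColumnSet D) (d : ℤ) :
    Face.shiftRow d ⁻¹' D = D := by
  ext f
  simp only [Set.mem_preimage]
  exact ⟨fun h => by simpa using hD _ h f.2, fun h => hD _ h _⟩

/-- `H(Θ)` is a union of columns. [cite: GlazmanManolescu2019, §1] -/
theorem isColumnSet_halfPlane : IsColumnSet halfPlane := fun _ hf _ => hf

/-- `Strip_T(Θ)` is a union of columns. [cite: GlazmanManolescu2019, §1] -/
theorem isColumnSet_strip (T : ℕ) : IsColumnSet (strip T) := fun _ hf _ => hf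

namespace YBWalk

variable {D : Set Face} {a z a' z' : MidEdge}

/-- Transport of a walk along equalities of its endpoints. [folklore] -/
def copy (γ : YBWalk D a z) (ha : a = a') (hz : z = z') : YBWalk D a' z' where
  mids := γ.mids
  head_eq := ha ▸ γ.head_eq
  getLast_eq := hz ▸ γ.getLast_eq
  nodup := γ.nodup
  arc_mem := γ.arc_mem
  isChain := γ.isChain
  noncross := γ.noncross

/-- `copy` does not change the mid-edges. [folklore] -/
@[simp] theorem mids_copy (γ : YBWalk D a z) (ha : a = a') (hz : z = z') :
    (γ.copy ha hz).mids = γ.mids := rfl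

/-- Vertical translation of a walk of a union of columns, as a walk of the same domain.
[cite: GlazmanManolescu2019, §4.2] -/
def shiftRowCol (hD : IsColumnSet D) (d : ℤ) (γ : YBWalk D a z) :
    YBWalk D (a.shiftRow d) (z.shiftRow d) :=
  (γ.shiftRow d).mapDomain (hD.preimage_shiftRow (-d)).subset

/-- The mid-edges of `shiftRowCol`. [folklore] -/
@[simp] theorem mids_shiftRowCol (hD : IsColumnSet D) (d : ℤ) (γ : YBWalk D a z) :
    (γ.shiftRowCol hD d).mids = γ.mids.map (MidEdge.shiftRow d) := rfl

/-- `shiftRowCol` preserves the weight. [cite: GlazmanManolescu2019, §4.2] -/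
@[simp] theorem weight_shiftRowCol (hD : IsColumnSet D) (d : ℤ) (Θ : ℤ → ℝ) (γ : YBWalk D a z) :
    (γ.shiftRowCol hD d).weight Θ = γ.weight Θ := by
  rw [shiftRowCol, weight_mapDomain, weight_shiftRow]

/-- Vertical translation is a bijection between walks of a union of columns.
[cite: GlazmanManolescu2019, §4.2] -/
def shiftRowEquiv (hD : IsColumnSet D) (d : ℤ) (a z : MidEdge) :
    YBWalk D a z ≃ YBWalk D (a.shiftRow d) (z.shiftRow d) where
  toFun γ := γ.shiftRowCol hD d
  invFun γ := (γ.shiftRowCol hD (-d)).copy (by simp) (by simp)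
  left_inv γ := by
    apply YBWalk.ext
    simp only [mids_copy, mids_shiftRowCol, List.map_map, Function.comp_def,
      MidEdge.shiftRow_shiftRow_neg, List.map_id']
  right_inv γ := by
    apply YBWalk.ext
    simp only [mids_copy, mids_shiftRowCol, List.map_map, Function.comp_def,
      MidEdge.shiftRow_neg_shiftRow, List.map_id']

end YBWalk

/-- **Translation invariance** of the two-point function of a union of columns.
[cite: GlazmanManolescu2019, §4.2 ("the invariance G_Θ(a,b) = G_Θ(0,b−a)")] -/
theorem twoPoint_shiftRow {D : Set Face} (hD : IsColumnSet D) (Θ : ℤ → ℝ) (d : ℤ) (a z : MidEdge) :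
    twoPoint D Θ (a.shiftRow d) (z.shiftRow d) = twoPoint D Θ a z := by
  unfold twoPoint
  rw [← (YBWalk.shiftRowEquiv hD d a z).tsum_eq]
  refine tsum_congr fun γ => ?_
  simp only [YBWalk.shiftRowEquiv, Equiv.coe_fn_mk, YBWalk.weight_shiftRowCol]

/-- `G_Θ(a, b) = G_Θ(0, b − a)` for boundary points of rows `a = m`, `b = n`.
[cite: GlazmanManolescu2019, §4.2 (last line of the proof of Theorem 1)] -/
theorem halfPlaneTwoPoint_eq_zero_sub (Θ : ℤ → ℝ) (m n : ℤ) :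
    halfPlaneTwoPoint Θ m n = halfPlaneTwoPoint Θ 0 (n - m) := by
  unfold halfPlaneTwoPoint boundaryPoint
  rw [← twoPoint_shiftRow isColumnSet_halfPlane Θ m (.vert 0 0) (.vert 0 (n - m))]
  simp [MidEdge.shiftRow]

/-! ### Exhaustion of the half-plane by strips -/

/-- Strips increase with their width. [cite: GlazmanManolescu2019, §1] -/
theorem strip_mono {T T' : ℕ} (h : T ≤ T') : strip T ⊆ strip T' :=
  fun _ hf => ⟨hf.1, by have := hf.2; omega⟩

/-- `T ↦ G_{Strip_T(Θ)}(a, z)` is non-decreasing. [cite: GlazmanManolescu2019, §4.2] -/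
theorem twoPoint_strip_mono (Θ : ℤ → ℝ) (a z : MidEdge) :
    Monotone fun T : ℕ => twoPoint (strip T) Θ a z :=
  fun _ _ h => twoPoint_mono (strip_mono h) Θ a z

namespace YBWalk

variable {D : Set Face} {a z : MidEdge}

/-- Restricting the domain of a walk to any set of faces containing the faces it visits.
[folklore] -/
def restrict (γ : YBWalk D a z) (D' : Set Face) (h : ∀ f ∈ γ.facesVisited, f ∈ D') :
    YBWalk D' a z where
  mids := γ.mids
  head_eq := γ.head_eq
  getLast_eq := γ.getLast_eq
  nodup := γ.nodup
  arc_mem p hp := by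
    obtain ⟨f, -, hpf⟩ := γ.arc_mem p hp
    refine ⟨f, h f ?_, hpf⟩
    simp only [facesVisited, List.mem_toFinset, List.mem_filterMap]
    exact ⟨p, hp, hpf⟩
  isChain := γ.isChain
  noncross := γ.noncross

/-- Restricting then enlarging the domain gives back the walk. [folklore] -/
@[simp] theorem mapDomain_restrict (γ : YBWalk D a z) {D' : Set Face}
    (h : ∀ f ∈ γ.facesVisited, f ∈ D') (h' : D' ⊆ D) : (γ.restrict D' h).mapDomain h' = γ := rfl

/-- A bound on the columns visited by a walk: every visited face `f` has `f.1 < colBound`.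
[folklore] -/
def colBound (γ : YBWalk D a z) : ℕ := γ.facesVisited.sup fun f => f.1.toNat + 1

/-- Visited faces lie in columns `< colBound`. [folklore] -/
theorem lt_colBound (γ : YBWalk D a z) {f : Face} (hf : f ∈ γ.facesVisited) :
    f.1 < γ.colBound := by
  have : f.1.toNat + 1 ≤ γ.colBound := Finset.le_sup (f := fun f : Face => f.1.toNat + 1) hf
  omega

/-- A walk of the half-plane visits only faces of the strip of width `colBound`.
[cite: GlazmanManolescu2019, §4.2] -/
theorem mem_strip_of_mem_facesVisited (γ : YBWalk halfPlane a z) {T : ℕ} (hT : γ.colBound ≤ T)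
    {f : Face} (hf : f ∈ γ.facesVisited) : f ∈ strip T :=
  ⟨γ.mem_of_mem_facesVisited hf, by have := γ.lt_colBound hf; omega⟩

end YBWalk

/-- **Exhaustion.** The two-point function of the half-plane is the supremum (increasing limit)
of those of the strips: every walk visits finitely many rhombi.
[cite: GlazmanManolescu2019, §4.2 (proof of Theorem 1, "G_Θ(0,L) ≥ lim_T G_T(Θ)(0,L)")] -/
theorem twoPoint_halfPlane_eq_iSup (Θ : ℤ → ℝ) (a z : MidEdge) :
    twoPoint halfPlane Θ a z = ⨆ T : ℕ, twoPoint (strip T) Θ a z := by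
  refine le_antisymm ?_ (iSup_le fun T => twoPoint_mono (strip_subset_halfPlane T) Θ a z)
  unfold twoPoint
  rw [ENNReal.tsum_eq_iSup_sum]
  refine iSup_le fun s => ?_
  set T : ℕ := s.sup YBWalk.colBound with hT
  let φ : YBWalk (strip T) a z → YBWalk halfPlane a z := YBWalk.mapDomain (strip_subset_halfPlane T)
  have hφ : Function.Injective φ := YBWalk.mapDomain_injective _
  have hrange : ∀ γ ∈ s, γ ∈ Set.range φ := fun γ hγ =>
    ⟨γ.restrict (strip T) fun f hf => γ.mem_strip_of_mem_facesVisited (Finset.le_sup hγ) hf, rfl⟩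
  calc ∑ γ ∈ s, ENNReal.ofReal (γ.weight Θ)
      = ∑ γ ∈ s.preimage φ hφ.injOn, ENNReal.ofReal ((φ γ).weight Θ) :=
        (Finset.sum_preimage φ s hφ.injOn (fun γ => ENNReal.ofReal (γ.weight Θ))
          (fun γ hγ hn => absurd (hrange γ hγ) hn)).symm
    _ ≤ ∑' γ : YBWalk (strip T) a z, ENNReal.ofReal (γ.weight Θ) := by
        simp only [φ, YBWalk.weight_mapDomain]; exact ENNReal.sum_le_tsum _
    _ ≤ ⨆ T : ℕ, ∑' γ : YBWalk (strip T) a z, ENNReal.ofReal (γ.weight Θ) :=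
        le_iSup (fun T : ℕ => ∑' γ : YBWalk (strip T) a z, ENNReal.ofReal (γ.weight Θ)) T

/-- Exchange of a monotone supremum and a sum in `ℝ≥0∞` (monotone convergence for series).
[folklore] -/
theorem iSup_tsum_eq_tsum_iSup_of_monotone {α : Type*} {f : ℕ → α → ℝ≥0∞}
    (hf : ∀ a, Monotone fun n => f n a) : (⨆ n, ∑' a, f n a) = ∑' a, ⨆ n, f n a := by
  refine le_antisymm (iSup_le fun n => ENNReal.tsum_le_tsum fun a => le_iSup (fun n => f n a) n) ?_
  rw [ENNReal.tsum_eq_iSup_sum]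
  refine iSup_le fun s => ?_
  rw [ENNReal.finsetSum_iSup_of_monotone fun a => hf a]
  exact iSup_mono fun n => ENNReal.sum_le_tsum s

/-! ### Arcs and the boundary of the strip -/

/-- The points of the boundary of `Strip_T(Θ)`: the midpoints `vert 0 j` of its left side and
`vert T j` of its right side. [cite: GlazmanManolescu2019, §1 and Proposition 4.2] -/
def stripBoundaryPoints (T : ℕ) : Set MidEdge := {e | ∃ j : ℤ, e = .vert 0 j ∨ e = .vert T j}

/-- Left-boundary points are boundary points of every strip. [cite: GlazmanManolescu2019, §1] -/
theorem boundaryPoint_mem_stripBoundaryPoints (T : ℕ) (m : ℤ) :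
    boundaryPoint m ∈ stripBoundaryPoints T :=
  ⟨m, Or.inl rfl⟩

/-- **`A_{T,Θ}`, the partition function of (self-avoiding) arcs of `Strip_T(Θ)`**: walks of the
strip from `0` to a point of its left boundary `α`, the empty walk excluded ("the factor `1` …
comes from the contribution to `F` of the empty configuration, which is not accounted for in any
of the terms on the left-hand side"), i.e. `A_{T,Θ} = Σ_{L ≠ 0} G_{Strip_T(Θ)}(0, L)` (the only
walk from `0` to `0` being the empty one, `twoPoint_self`).
[cite: GlazmanManolescu2019, §2.1 (A_{T,L,Θ}, A_{T,Θ}) and §4.2 ("A_{T,Θ} = Σ_L G_{S_T(Θ)}(0,L)")] -/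
def arcPartitionFunction (T : ℕ) (Θ : ℤ → ℝ) : ℝ≥0∞ :=
  ∑' L : ℤ, if L = 0 then 0 else twoPoint (strip T) Θ origin (boundaryPoint L)

/-! ### Named facts (the inputs of the proof of Theorem 1) -/

/-- **Glazman–Manolescu, Corollary 2.3** (the strip identity of the parafermionic observable).
"For any sequence `Θ = {θ_k}` of angles between `π/3` and `2π/3`,
`cos(3π/8) A_{T,Θ} + B_{T,Θ} = 1`", where `A_{T,Θ}` and `B_{T,Θ}` are "the partition functions
of arcs and bridges, respectively, in `Strip_T(Θ)`" (`arcPartitionFunction`,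
`bridgePartitionFunction`; strips of width `T ≥ 1`). Consequence of Lemma 2.2 (= [Gl, Lem. 4.1],
the discrete contour identity of the parafermionic observable in `Rect_{T,L}(Θ)`) by `L → ∞`.
[cite: GlazmanManolescu2019, Corollary 2.3, eq. (2.5)] -/
def GlazmanManolescu2019_cor23 : Prop :=
  ∀ Θ : ℤ → ℝ, (∀ k, Θ k ∈ Set.Icc (π / 3) (2 * π / 3)) → ∀ T : ℕ, 1 ≤ T →
    ENNReal.ofReal (Real.cos (3 * π / 8)) * arcPartitionFunction T Θ +
      bridgePartitionFunction T Θ = 1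

/-- **Glazman–Manolescu, Proposition 1.1, consequence** (originally [BBDDG]). "As a
consequence, the partition function of self-avoiding bridges on the hexagonal lattice vanishes
at infinity: `B_T(π/3) → 0` as `T → ∞`" (all angles equal to `π/3`; the quantitative statement
`Σ_T (B_T(π/3))³ / T < ∞` of the Proposition is not needed for Theorem 1).
[cite: GlazmanManolescu2019, Proposition 1.1] -/
def GlazmanManolescu2019_prop11_limit : Prop :=
  Tendsto (fun T => bridgePartitionFunction T (fun _ => π / 3)) atTop (𝓝 0)

/-- **Glazman–Manolescu, Proposition 4.2** (column exchange by Yang–Baxter transformations).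
"Let `Strip_T(Θ)` be a vertical strip tiled with `T` columns with angles `θ_1, …, θ_T`. Then
for any `a, b` on the boundary of `Strip_T(Θ)` the 2-point function `G(a, b)` does not depend on
the order of angles": for every permutation `σ` of the columns `0, …, T-1` of the strip
(extended by the identity to the other indices, which do not belong to the strip),
`G_{Strip_T(Θ ∘ σ)}(a, b) = G_{Strip_T(Θ)}(a, b)` (angles in `[π/3, 2π/3]`, as "during the whole
section", §4). [cite: GlazmanManolescu2019, Proposition 4.2] -/
def GlazmanManolescu2019_prop42 : Prop :=
  ∀ (T : ℕ) (Θ : ℤ → ℝ) (σ : Equiv.Perm ℤ), (∀ k, Θ k ∈ Set.Icc (π / 3) (2 * π / 3)) →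
    (∀ k, k < 0 ∨ (T : ℤ) ≤ k → σ k = k) →
    ∀ a ∈ stripBoundaryPoints T, ∀ b ∈ stripBoundaryPoints T,
      twoPoint (strip T) (Θ ∘ σ) a b = twoPoint (strip T) Θ a b

/-- **Glazman–Manolescu, Lemma 4.3.** "Let `Θ = (θ_1, …, θ_T)` be a finite sequence of angles
with `θ_k ∈ [π/3, 2π/3]` for all `k`. Then for any two points `a, b` on the left boundary of
`Strip_T(Θ)` we have `G_{Strip_T(Θ)}(a, b) ≥ G_{Strip_T(θ_1, …, θ_{T-1}, π/3)}(a, b)`" (the last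
column is column `T - 1` in our indexing from `0`). [cite: GlazmanManolescu2019, Lemma 4.3] -/
def GlazmanManolescu2019_lem43 : Prop :=
  ∀ (T : ℕ) (Θ : ℤ → ℝ), 1 ≤ T → (∀ k, Θ k ∈ Set.Icc (π / 3) (2 * π / 3)) → ∀ m n : ℤ,
    twoPoint (strip T) (Function.update Θ ((T : ℤ) - 1) (π / 3)) (boundaryPoint m)
        (boundaryPoint n) ≤
      twoPoint (strip T) Θ (boundaryPoint m) (boundaryPoint n)

/-! ### Corollary 4.4 from Proposition 4.2 and Lemma 4.3 -/

/-- `π/3` is an admissible angle. [cite: GlazmanManolescu2019, §1] -/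
theorem pi_div_three_mem_Icc : π / 3 ∈ Set.Icc (π / 3) (2 * π / 3) :=
  ⟨le_rfl, by linarith [Real.pi_pos]⟩

/-- The cyclic rotation of the columns `0, …, T-1` bringing the last column first:
`σ 0 = T - 1`, `σ k = k - 1` for `1 ≤ k < T`, identity elsewhere — the permutation with
`(θ_1, …, θ_{T-1}, π/3) ∘ σ = (π/3, θ_1, …, θ_{T-1})` used in the proof of Corollary 4.4.
[cite: GlazmanManolescu2019, proof of Corollary 4.4] -/
def rotPerm (T : ℕ) : Equiv.Perm ℤ where
  toFun k := if 0 ≤ k ∧ k < T then (if k = 0 then (T : ℤ) - 1 else k - 1) else k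
  invFun k := if 0 ≤ k ∧ k < T then (if k = (T : ℤ) - 1 then 0 else k + 1) else k
  left_inv k := by
    simp only
    split_ifs <;> omega
  right_inv k := by
    simp only
    split_ifs <;> omega

/-- `rotPerm` unfolded. [folklore] -/
theorem rotPerm_apply (T : ℕ) (k : ℤ) :
    rotPerm T k = if 0 ≤ k ∧ k < T then (if k = 0 then (T : ℤ) - 1 else k - 1) else k := rfl

/-- `rotPerm` fixes the indices that are not columns of the strip. [folklore] -/
theorem rotPerm_of_not_mem (T : ℕ) (k : ℤ) (hk : k < 0 ∨ (T : ℤ) ≤ k) : rotPerm T k = k := by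
  rw [rotPerm_apply]; split_ifs <;> omega

/-- **Glazman–Manolescu, Corollary 4.4, eq. (4.5), from Proposition 4.2 and Lemma 4.3.** "Let
`Θ = (θ_1, …, θ_T)` be a finite sequence of angles with `θ_k ∈ [π/3, 2π/3]` for all `k`. Then for
any two points `a, b` on the left boundary of `Strip_T(Θ)` … `G_{Strip_T(Θ)}(a, b) ≥ G_{Strip_T(π/3)}(a, b)`,
where the right hand side is the strip of width `T` with all angles equal to `π/3`." The proof is
the printed one: Lemma 4.3 replaces the last angle by `π/3`, Proposition 4.2 rotates that column
to the front, "to obtain (4.5) it suffices to apply repeatedly (4.4)" (`T` times), and the angles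
outside the strip are irrelevant (`twoPoint_congr`). With Lemma 4.3 discharged
(`YangBaxterSAWStripMonotone.lean`, `GlazmanManolescu2019_cor44_of_prop42`) the bound holds as soon
as Proposition 4.2 does; it is not vendored as a separate named fact.
[cite: GlazmanManolescu2019, Corollary 4.4, eq. (4.5) (statement and proof)] -/
theorem GlazmanManolescu2019_cor44_of (h42 : GlazmanManolescu2019_prop42)
    (h43 : GlazmanManolescu2019_lem43) (T : ℕ) (Θ : ℤ → ℝ)
    (hΘ : ∀ k, Θ k ∈ Set.Icc (π / 3) (2 * π / 3)) (m n : ℤ) :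
    twoPoint (strip T) (fun _ => π / 3) (boundaryPoint m) (boundaryPoint n) ≤
      twoPoint (strip T) Θ (boundaryPoint m) (boundaryPoint n) := by
  rcases Nat.eq_zero_or_pos T with rfl | hT
  · rw [twoPoint_congr (strip 0) (Θ' := Θ) (fun f hf => absurd hf.2 (by simp [hf.1])) _ _]
  -- `Θj j` : the first `j` columns set to `π/3`, the others shifted to the right by `j`
  let Θj : ℕ → ℤ → ℝ := fun j k => if 0 ≤ k ∧ k < j then π / 3 else Θ (k - j)
  have hΘj : ∀ j k, Θj j k ∈ Set.Icc (π / 3) (2 * π / 3) := fun j k => by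
    simp only [Θj]; split_ifs
    · exact pi_div_three_mem_Icc
    · exact hΘ _
  have hupd : ∀ j k, Function.update (Θj j) ((T : ℤ) - 1) (π / 3) k ∈ Set.Icc (π / 3) (2 * π / 3) := by
    intro j k
    rcases eq_or_ne k ((T : ℤ) - 1) with rfl | hk
    · rw [Function.update_self]; exact pi_div_three_mem_Icc
    · rw [Function.update_of_ne hk]; exact hΘj j k
  have step : ∀ j : ℕ, twoPoint (strip T) (Θj (j + 1)) (boundaryPoint m) (boundaryPoint n) ≤
      twoPoint (strip T) (Θj j) (boundaryPoint m) (boundaryPoint n) := by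
    intro j
    calc twoPoint (strip T) (Θj (j + 1)) (boundaryPoint m) (boundaryPoint n)
        = twoPoint (strip T) (Function.update (Θj j) ((T : ℤ) - 1) (π / 3) ∘ rotPerm T)
            (boundaryPoint m) (boundaryPoint n) := by
          refine twoPoint_congr (strip T) (fun f hf => ?_) _ _
          obtain ⟨h0, hT'⟩ := hf
          simp only [Function.comp_apply, Function.update_apply, rotPerm_apply, Θj, Nat.cast_add,
            Nat.cast_one]
          split_ifs <;> first | rfl | (congr 1; omega)
      _ = twoPoint (strip T) (Function.update (Θj j) ((T : ℤ) - 1) (π / 3))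
            (boundaryPoint m) (boundaryPoint n) :=
          h42 T _ (rotPerm T) (hupd j) (rotPerm_of_not_mem T) _
            (boundaryPoint_mem_stripBoundaryPoints T m) _ (boundaryPoint_mem_stripBoundaryPoints T n)
      _ ≤ twoPoint (strip T) (Θj j) (boundaryPoint m) (boundaryPoint n) :=
          h43 T (Θj j) hT (hΘj j) m n
  have chain : ∀ j : ℕ, twoPoint (strip T) (Θj j) (boundaryPoint m) (boundaryPoint n) ≤
      twoPoint (strip T) (Θj 0) (boundaryPoint m) (boundaryPoint n) := by
    intro j
    induction j with
    | zero => exact le_rfl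
    | succ j ih => exact (step j).trans ih
  have h0 : Θj 0 = Θ := by
    funext k; simp [Θj]
  calc twoPoint (strip T) (fun _ => π / 3) (boundaryPoint m) (boundaryPoint n)
      = twoPoint (strip T) (Θj T) (boundaryPoint m) (boundaryPoint n) :=
        twoPoint_congr (strip T) (fun f hf => by simp only [Θj]; rw [if_pos ⟨hf.1, hf.2⟩]) _ _
    _ ≤ twoPoint (strip T) Θ (boundaryPoint m) (boundaryPoint n) := h0 ▸ chain T

/-! ### Theorem 1 from Corollary 2.3, Proposition 1.1 and Corollary 4.4 -/

/-- `cos(3π/8) > 0`. [folklore] -/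
theorem cos_three_pi_div_eight_pos : 0 < Real.cos (3 * π / 8) := by
  apply Real.cos_pos_of_mem_Ioo
  constructor <;> linarith [Real.pi_pos]

/-- The row-`L` term of the arc partition function of the half plane: `G_Θ(0, L)` for `L ≠ 0`,
`0` for `L = 0`. [cite: GlazmanManolescu2019, §4.2 ("Σ_L G_Θ(0,L)")] -/
def arcTerm (Θ : ℤ → ℝ) (L : ℤ) : ℝ≥0∞ := if L = 0 then 0 else halfPlaneTwoPoint Θ 0 L

/-- `G_Θ(0, L) = lim_T G_{Strip_{T+1}(Θ)}(0, L)` (increasing limit), termwise.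
[cite: GlazmanManolescu2019, §4.2] -/
theorem arcTerm_eq_iSup (Θ : ℤ → ℝ) (L : ℤ) :
    arcTerm Θ L = ⨆ T : ℕ, if L = 0 then 0 else twoPoint (strip (T + 1)) Θ origin (boundaryPoint L) := by
  unfold arcTerm
  split_ifs with hL
  · simp
  · rw [halfPlaneTwoPoint, twoPoint_halfPlane_eq_iSup]
    exact ((twoPoint_strip_mono Θ _ _).iSup_nat_add 1).symm

/-- `lim_T A_{T,Θ} = Σ_L lim_T G_{Strip_T(Θ)}(0, L) = Σ_{L ≠ 0} G_Θ(0, L)` ("`Σ_L lim_T = lim_T Σ_L`",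
monotone convergence). [cite: GlazmanManolescu2019, §4.2 (proof of Theorem 1)] -/
theorem iSup_arcPartitionFunction (Θ : ℤ → ℝ) :
    (⨆ T : ℕ, arcPartitionFunction (T + 1) Θ) = ∑' L : ℤ, arcTerm Θ L := by
  unfold arcPartitionFunction
  rw [iSup_tsum_eq_tsum_iSup_of_monotone]
  · exact tsum_congr fun L => (arcTerm_eq_iSup Θ L).symm
  · intro L T T' h
    dsimp only
    split_ifs
    · exact le_rfl
    · exact twoPoint_strip_mono Θ _ _ (by omega)

/-- **Theorem 1 from Corollary 2.3, Proposition 1.1 (`B_T(π/3) → 0`) and Corollary 4.4**, the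
proof printed in §4.2: (a) by Cor. 2.3, `cos(3π/8) A_{T,Θ'} ≤ 1` for every admissible `Θ'`,
hence `cos(3π/8) Σ_{L≠0} G_{Θ'}(0, L) ≤ 1` (monotone limits); (b) for `Θ' ≡ π/3`, Cor. 2.3 and
`B_{T,π/3} → 0` give `cos(3π/8) Σ_{L≠0} G_{π/3}(0, L) = 1`; (c) by Cor. 4.4 and exhaustion,
`G_{π/3}(0, L) ≤ G_Θ(0, L)` termwise, so the sum for `Θ` is also `1/cos(3π/8)`; (d) equal finite
sums of termwise ordered families agree termwise; (e) `G(a, b) = G(0, b − a)` and `G(a, a) = 1`.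
The hypothesis `h44` is the bound (4.5) of Corollary 4.4, spelled out (it is supplied by
`GlazmanManolescu2019_cor44_of h42 h43`, see `GlazmanManolescu2019_thm1_of_cor23_prop11_prop42` in
`YangBaxterSAWStripMonotone.lean`). [cite: GlazmanManolescu2019, Theorem 1 (proof, §4.2)] -/
theorem GlazmanManolescu2019_thm1_of (h23 : GlazmanManolescu2019_cor23)
    (h11 : GlazmanManolescu2019_prop11_limit)
    (h44 : ∀ (T : ℕ) (Θ : ℤ → ℝ), (∀ k, Θ k ∈ Set.Icc (π / 3) (2 * π / 3)) → ∀ m n : ℤ,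
      twoPoint (strip T) (fun _ => π / 3) (boundaryPoint m) (boundaryPoint n) ≤
        twoPoint (strip T) Θ (boundaryPoint m) (boundaryPoint n)) :
    GlazmanManolescu2019_thm1 := by
  intro Θ hΘ m n
  rw [halfPlaneTwoPoint_eq_zero_sub Θ, halfPlaneTwoPoint_eq_zero_sub (fun _ => π / 3)]
  generalize n - m = L
  rcases eq_or_ne L 0 with rfl | hL
  · simp only [halfPlaneTwoPoint, twoPoint_self]
  set hex : ℤ → ℝ := fun _ => π / 3 with hhex_def
  have hhex : ∀ k, hex k ∈ Set.Icc (π / 3) (2 * π / 3) := fun _ => pi_div_three_mem_Icc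
  set c : ℝ≥0∞ := ENNReal.ofReal (Real.cos (3 * π / 8)) with hc_def
  have hc0 : c ≠ 0 := by simpa [hc_def] using cos_three_pi_div_eight_pos
  have hctop : c ≠ ⊤ := ENNReal.ofReal_ne_top
  -- the total arc weight `S Θ' = Σ_{L ≠ 0} G_Θ'(0, L)` of the half-plane
  set S : (ℤ → ℝ) → ℝ≥0∞ := fun Θ' => ∑' L, arcTerm Θ' L with hS_def
  -- (a) `c * S Θ' ≤ 1` for every admissible `Θ'` (Cor. 2.3)
  have hSle : ∀ Θ' : ℤ → ℝ, (∀ k, Θ' k ∈ Set.Icc (π / 3) (2 * π / 3)) → c * S Θ' ≤ 1 := by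
    intro Θ' hΘ'
    simp only [hS_def, ← iSup_arcPartitionFunction, ENNReal.mul_iSup]
    refine iSup_le fun T => ?_
    calc c * arcPartitionFunction (T + 1) Θ'
        ≤ c * arcPartitionFunction (T + 1) Θ' + bridgePartitionFunction (T + 1) Θ' := le_self_add
      _ = 1 := h23 Θ' hΘ' (T + 1) (by omega)
  -- (b) `c * S hex = 1` (Cor. 2.3 and `B_{T,π/3} → 0`)
  have hShex : c * S hex = 1 := by
    refine le_antisymm (hSle hex hhex) ?_
    simp only [hS_def, ← iSup_arcPartitionFunction, ENNReal.mul_iSup]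
    refine ENNReal.le_of_forall_pos_le_add fun ε hε _ => ?_
    obtain ⟨N, hN⟩ := ENNReal.tendsto_atTop_zero.1 h11 ε (by exact_mod_cast hε)
    calc (1 : ℝ≥0∞) = c * arcPartitionFunction (N + 1) hex + bridgePartitionFunction (N + 1) hex :=
          (h23 hex hhex (N + 1) (by omega)).symm
      _ ≤ (⨆ T : ℕ, c * arcPartitionFunction (T + 1) hex) + ε :=
          add_le_add (le_iSup (fun T : ℕ => c * arcPartitionFunction (T + 1) hex) N)
            (hN (N + 1) (by omega))
  -- (c) `S hex ≤ S Θ` termwise (Cor. 4.4), hence `c * S Θ = 1` too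
  have hterm : ∀ L, arcTerm hex L ≤ arcTerm Θ L := by
    intro L
    rw [arcTerm_eq_iSup, arcTerm_eq_iSup]
    refine iSup_mono fun T => ?_
    split_ifs
    · exact le_rfl
    · exact h44 (T + 1) Θ hΘ 0 L
  have hSΘ : c * S Θ = 1 := by
    refine le_antisymm (hSle Θ hΘ) ?_
    calc (1 : ℝ≥0∞) = c * S hex := hShex.symm
      _ ≤ c * S Θ := by gcongr; exact ENNReal.tsum_le_tsum hterm
  have hSeq : S hex = S Θ := (ENNReal.mul_right_inj hc0 hctop).1 (hShex.trans hSΘ.symm)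
  have hStop : S hex ≠ ⊤ := by
    intro h
    rw [h, ENNReal.mul_top hc0] at hShex
    exact ENNReal.top_ne_one hShex
  -- (d) equal finite sums of termwise ordered families are termwise equal
  have key : arcTerm hex L = arcTerm Θ L := by
    by_contra hne
    exact (ENNReal.tsum_lt_tsum hStop hterm ((hterm L).lt_of_ne hne)).ne hSeq
  simpa [arcTerm, hL] using key.symm

end Literature.Probability.RandomPlanarGeometry.SAW.YangBaxter
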